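import Literature.MathematicalPhysics.QuantumFieldTheory.Balaban1983to89.B9Thm314QGQInvFlatV1Transfer

/-!
# `Balaban1983to89.B9Thm314QGQFlatV1` — [B9] THEOREM 3.14 (pp. 426–427, (3.154)) AT `U = 1` FOR THE KERNEL (2.142) OF THE GENUINE
`k`-LEVEL `QGQ*` ON THE V1 TORUS, FILE Q1 OF 3: for two nested families `{Ω_j}`, `{Ω′_j}` on one torus and every pair of COMMON TOP
index bonds `u, v`, `|(QG[Ω′]Q*)(u, v) − (QG[Ω]Q*)(u, v)| ≤ C_Δ·Λ_uΛ′_v·e^{−δd(βu, β′v, Ω)}` — the input `hΔ` of the transfer engine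
`B9Thm314QGQInvFlatV1Transfer.term_le` (hypothesis-level: the two-family bound of `G[Ω] − G[Ω′]` and the one-family (2.142) bounds are
displayed hypotheses, discharged in file Q3; theorems only; no existing module is touched; no fact is minted)

FRAMING (verbatim cell line):
statement-level skeleton of published theorems with citation tags; proofs where landed; nothing here is a claim about the Yang–Mills mass gap

Sources under audit (cell lit-balaban): T. Bałaban, *Propagators for lattice gauge theories in a background field*, Commun.
Math. Phys. **99** (1985) 389–434 [`Balaban1985BackgroundPropagators`, "B9"], pp. 426–427 [PDF 38–39] (Theorem 3.14, (3.154)) —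
held text `paper:balaban1985-cmp99-background-propagators` p0038/p0039 re-read this generation; T. Bałaban, *Propagators and
renormalization transformations for lattice gauge theories. II*, Commun. Math. Phys. **96** (1984) 223–250
[`Balaban1984PropagatorsII`, "[4]"], (2.142) p. 248, (2.45)–(2.46) p. 231, (2.1)–(2.3) p. 224; [`Balaban1984PropagatorsI`] (1.18)
p. 20 (the averages `Q_k`).  Unit `lit-balaban-p21` (Phase-2 proof seat p21 gen 24, HOME `run/shared/lean/pub/lit-balaban/`,
free-target protocol G.5-34(d), TAKING 2026-08-25T03:23Z; B9 fold owner r06, B6 fold owner r03, referee ref-4).  Companion files: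
Q2 `B9Thm314QGQInvFlatV1Transfer` (imported: index-bond geometry of (3.154)), Q3 `B9Thm314QGQInvFlatV1MultiLevelTorus` (instantiation).

## WHAT IS PRINTED (quotations AS PRINTED; «…» marks our elisions)

B9 p. 426: «We construct operators for both sequences and we define Ω = Ω_k ∩ Ω′_k. Let us take localizations determined by points
y, y′ ∈ Ω^{(k)} («…» the points y, y′ in the case of (Q′G′²Q′*)⁻¹, (QGQ*)⁻¹, etc.). We have **Theorem 3.14.** If we take a pair of
operators constructed for the two sequences {Ω_j}, {Ω′_j}, then their difference satisfies all the inequalities characteristic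
for operators of the considered type, with the additional factor exp(−δ₀d(y, y′, Ω)), d(y, y′, Ω) = inf_{y₁∈Ωᶜ∩T^{(k)}} (|y − y₁| +
|y₁ − y′|) (3.154) on the right-hand sides.» (p. 427) «Remaining terms correspond to walks of the general type (3.107), for which
at least one localization X_i intersects Ωᶜ.»  [4] p. 248: «From (2.136) we have |(QGQ*)(b, b′)| ≤ O(1)(L^jη)²(L^{j′}η)^{−d}e^{−δ₃d(b,b′)},
b ∈ Λ_j, b′ ∈ Λ_{j′}. (2.142)»  [`Balaban1984PropagatorsI`] p. 20: «(Q_kA)_b = Σ_{x∈B^k(b₋)} η^{d+1} A([x, x(b)]) (1.18)».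

## WHAT THIS FILE CERTIFIES (kernel-checked; V1 torus `B6GlobalChartV1.PV`, families `domT hN D hk` of p21's `TDomains`; lattice units)

For two families `D, D′ : TDomains` on one torus, their index bonds (r03's W2/W3 setting: `lvl`, carrier blocks `β`, weights
`Λ = lam`, `ρ = d_T ∘ β`, the flat matrix `X = ⟪e_·, QGQ*e_·⟫`), the common top index bonds `IsCT` of `B9Thm314GFlatV1Kernel` and
`dOmega D D′` of `B9Thm314GpFlatTorusGeometry`:
* §1 dictionary: `common_top_of_levs` (a site with both levels `k` lies in a common top block, label = its `k`-label),
  **`tdistK_tube_beta_le`** (every site of the tube `B^k(c₋) ∪ B^k(c₊)` of a top index bond is within `3` of its carrier block on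
  `T^{(k)}`), `lam_mul_lam_of_top` (`Λ_uΛ′_v = (L^k/c_f)²(L^{kD})⁻¹`), **`X_sub_X_eq`** (the two-family difference of (2.142) as ONE
  average `(Q[(G′ − G)q′_v])_u`: the averages `(Q·)_u = (Q·)_ũ` and the weights `q_{v_D} = q′_v` of twins coincide, (1.18));
* §2 BOTH TUBES INSIDE `Ω` (all four end-points in `Ω_k^{(k)}` of both families): `levs_of_tube`, **`contour_inside_le`** — split
  `q′_v` over the `≤ 2L^D` blocks met by the tube of `v` (`B6Ineq2142KLevelV1.card_metBlocks_le`), each a common top block, apply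
  the displayed two-family bound `hdiff` of `G[Ω] − G[Ω′]` (the literal conclusion shape of `B9Thm314GFlatV1Transfer.thm314_G_flat_V1`)
  with `|q′_v| ≤ L^{−kD}`, and move the (3.154) factor from the blocks to the carrier blocks (`±3` twice) — and **`X_sub_X_inside_le`**:
  `|X′(ũ,v) − X(u,v_D)| ≤ 2L^D·C·e^{6δ}·Λ_uΛ′_v·e^{−δd(βu,β′v,Ω)}`;
* §3 A TUBE TOUCHING `Ωᶜ`: `exists_bad_site_of_not_inside` (print's «at least one localization … intersects Ωᶜ»),
  `dOmega_le_tdistK_add_six`, **`X_sub_X_outside_le`**: the one-family (2.142) bounds (flat form, both families) already carry the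
  factor: `≤ 2A′e^{9δ}·Λ_uΛ′_v·e^{−δd(βu,β′v,Ω)}`;
* §4 **`thm314_QGQ_flat_of_hyps`**: for ALL common top `u ∈ 𝔅[D]`, `v ∈ 𝔅[D′]`,
  `|X′(ũ, v) − X(u, v_D)| ≤ (2L^D·C·e^{6δ} + 2A′e^{9δ})·Λ_uΛ′_v·e^{−δ·d(βu, β′v, Ω)}`.

## HONEST SCOPE

* `U = 1` only; V1 torus lineage (`Ω₁ = T_η`, levels `1 … k`, lattice units); HYPOTHESIS-LEVEL in `hdiff` (two-family `G`-bound) and the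
  one-family (2.142) bounds (fed in file Q3 from `B9Thm314GFlatV1Transfer.thm314_G_flat_V1` and r03's `B6Ineq2142KLevelV1.ineq2142_kLevel`).
  Only COMMON TOP index bonds; the PLAIN decay `e^{−δd(b,b′)}` of (2.142) is not re-derived for the difference (the transfer engine takes
  it from the one-family bounds and restores it by the geometric mean, `B9Thm314QGQInvFlatV1Transfer.thm314_QGQinv_of_hyps`).
* (3.154) as in `B9Thm314GpFlatTorusGeometry` on the `k`-labels of the carrier blocks `β u ∈ 𝔅[D]`, `β′ v ∈ 𝔅[D′]` (base-end-point
  convention of `B6Ineq2142KLevelV1.β`; twins' carrier blocks differ by `≤ 3` on `T^{(k)}`, immaterial up to constants).  Constants ours.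
  Nothing is inferred from the manuscript: every step is kernel-checked; the quoted sentences locate the statements.  NOT summit progress.
-/

noncomputable section

open scoped BigOperators InnerProductSpace
open Finset

namespace Literature.MathematicalPhysics.QuantumFieldTheory.Balaban1983to89.B9Thm314QGQFlatV1

open B4Reflection242 (boxDom blk)
open B6MultiLevelBoxOperator (N0)
open B6MultiLevelTorusOperator (TDomains)
open B6Geom246MultiLevelBox (bset blkOf blkOf_val)
open B6Geom246MultiLevelTorus (geomT)
open B6SectAOperatorsV1 (QE QsE BondIdx BondIdxSpace)
open B6SectAVectorModelV1 (GE)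
open B6GlobalChartV1 (PV toBox domT blkV1 iterBlockOf_mem_domT_iff)
open B6Ineq2142KLevelV1 (lvl lvl_le lvl_le_mK one_le_lvl base baseSite iterBlockOf_baseSite β beta_level X qwt qwt_le qwt_nonneg
  exists_of_qwt_ne_zero QsE_single_apply abs_QE_apply_le iterBlockOf_runSite_mem metBlocks mem_metBlocks exists_of_mem_metBlocks
  card_metBlocks_le)
open B6Prop27KLevelV1 (wt lam lam_pos lam_sq rho)
open B6RandomWalk (BlockSupp blockPiece sum_blockPiece blockSupp_blockPiece)
open B6Ineq2133TwoScaleV1 (onFun onFun_apply)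
open B6Prop26KLevelSkeletonV1 (pref)
open B6AgreeQaQV1Chart (iterBlock_nonempty)
open B9Thm314GpFlatTorusGeometry (OmegaC blk_mem_OmegaC tdistK tdistK_nonneg dOmega dOmega_nonneg dOmega_le)
open B9Thm314QGGQInvFlatTransfer (tdistK_triangle tdistK_comm dOmega_le_tdistK_add dOmega_le_add_tdistK)
open B9Thm314GFlatV1Transfer (tdistK_blk_blk_le_of_dist dist_tube_le)
open B9Thm314GFlatV1Kernel (IsCT)
open B9Thm314QGQInvFlatV1Transfer (lam_twin lam_twin' beta_lab_eq baseSite_mem_tube tdistK_twin_le tdistK_twin_le' tdistK_le_rho_of_top)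
open B5Eq118OneStroke (iterBlockOf iterBlock mem_iterBlock)
open LatticeFieldCalculus (runBond runSite)
open BalabanImbrieJaffe1984to88.BIJ85AxialPropagator411 (BondSpace)

variable {d ℓ m K : ℕ} {hd : 1 ≤ d + 1} {hL : Odd (ℓ + 1) ∧ 1 < ℓ + 1}
variable {Mh k R : ℕ} {P' : Fin (d + 1) → ℕ}

/-! ## §1  Sites of `Ω = Ω_k ∩ Ω′_k`: common top blocks; the tube of a top index bond against its carrier block -/

section Dictionary

variable (hN : ∀ μ, N0 ℓ Mh k P' μ = (PV d ℓ m K hd hL).sitesPerDir 0) (D D' : TDomains d ℓ Mh k P' R) (hk : k ≤ m + K)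

/-- the block of a site of level `k` is the top block with the site's `k`-label. [cite: Balaban1984PropagatorsII, (2.1) p.224, (2.45) p.231] -/
theorem blkOf_val_of_lev_eq (D₀ : TDomains d ℓ Mh k P' R) (z : ↥(boxDom (N0 ℓ Mh k P'))) (h : D₀.lev z.1 = k) :
    (blkOf D₀.toDomains z).1 = (k, blk ((ℓ + 1) ^ k) z.1) := by
  rw [blkOf_val, TDomains.toDomains_lev, h]

/-- **A SITE OF `Ω` LIES IN A COMMON TOP BLOCK**: if both level functions are `k` at `z`, its `D`-block is a top block whose label is
also a block of `𝔅[D′]`. [cite: Balaban1985BackgroundPropagators, p.426 («Ω = Ω_k ∩ Ω′_k»); Balaban1984PropagatorsII, (2.1) p.224] -/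
theorem common_top_of_levs (z : ↥(boxDom (N0 ℓ Mh k P'))) (hD : D.lev z.1 = k) (hD' : D'.lev z.1 = k) :
    (blkOf D.toDomains z).1.1 = k ∧ (blkOf D.toDomains z).1 ∈ bset D'.toDomains ∧
      (blkOf D.toDomains z).1.2 = blk ((ℓ + 1) ^ k) z.1 := by
  have h1 := blkOf_val_of_lev_eq D z hD
  have h2 := blkOf_val_of_lev_eq D' z hD'
  refine ⟨by rw [h1], ?_, by rw [h1]⟩
  rw [h1, ← h2]
  exact (blkOf D'.toDomains z).2

/-- a site of the tube of an index bond of level `j` whose end-point lies in `Ω_j^{(j)}` has level `≥ j`. [cite: Balaban1984PropagatorsII, (2.1)–(2.3) p.224] -/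
theorem le_lev_of_mem_Om (D₀ : TDomains d ℓ Mh k P' R) {j : ℕ} (hj1 : 1 ≤ j) (hjk : j ≤ k) {z : Site (PV d ℓ m K hd hL) 0}
    {e : Site (PV d ℓ m K hd hL) j} (hz : iterBlockOf j z = e) (he : e ∈ (domT hN D₀ hk).Om j) :
    j ≤ D₀.lev (toBox hN z).1 := by
  have h := (iterBlockOf_mem_domT_iff hN D₀ hk hj1 hjk z).1
  rw [hz] at h
  exact h he

/-- **THE TUBE OF A TOP INDEX BOND IS `k`-CLOSE TO ITS CARRIER BLOCK**: `|z₁ − β u| ≤ 3` on `T^{(k)}` for every site `z` of the tube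
(`z₁` its `k`-lattice point; both `z` and the base site lie in the tube, torus diameter `≤ 2L^k`).
[cite: Balaban1985BackgroundPropagators, (3.154) p.427; Balaban1984PropagatorsI, (1.18) p.20] -/
theorem tdistK_tube_beta_le (D₀ : TDomains d ℓ Mh k P' R) (hk1 : 1 ≤ k) (u : BondIdx (domT hN D₀ hk)) (hu : (u.1.1 : ℕ) = k)
    {z : Site (PV d ℓ m K hd hL) 0}
    (hz : iterBlockOf (lvl hN D₀ hk u) z = u.1.2.src ∨ iterBlockOf (lvl hN D₀ hk u) z = u.1.2.tgt) :
    tdistK (ℓ := ℓ) (Mh := Mh) (k := k) (P := P') (blk ((ℓ + 1) ^ k) (toBox hN z).1) (β hN D₀ hk u).1.2 ≤ 3 := by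
  rw [beta_lab_eq hN hk D₀ hk1 u hu]
  have hx' := baseSite_mem_tube hN hk D₀ u
  have hjm : (u.1.1 : ℕ) ≤ m + K := lvl_le_mK hN D₀ hk u
  have hdist := dist_tube_le hN hjm hu.le u.1.2 hz hx'
  have := tdistK_blk_blk_le_of_dist (z := toBox hN z) (w := toBox hN (baseSite hN D₀ hk u)) (n := 2) (by exact_mod_cast hdist)
  linarith

/-- the weights of the averages of twins agree: `q_{v_D} = q′_v`. [cite: Balaban1984PropagatorsI, (1.18) p.20, bookkeeping] -/
theorem qwt_twin' (v : BondIdx (domT hN D' hk)) (h : IsCT hN D D' hk v.1) : qwt hN D hk ⟨v.1, h.2.1⟩ = qwt hN D' hk v := rfl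

/-- `Λ` of a top index bond: `Λ = √((L^k/c_f)²·L^{−kD})`. [cite: Balaban1984PropagatorsII, (2.81) p.237, (2.142) p.248, bookkeeping] -/
theorem lam_eq_of_top (D₀ : TDomains d ℓ Mh k P' R) (cf : ℝ) (a : BondIdx (domT hN D₀ hk)) (ha : (a.1.1 : ℕ) = k) :
    lam hN D₀ hk cf a = Real.sqrt (((((ℓ + 1 : ℕ) : ℝ)) ^ k / cf) ^ 2 * ((((ℓ + 1 : ℕ) : ℝ) ^ (d + 1)) ^ k)⁻¹) := by
  unfold lam wt lvl
  rw [ha]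

/-- **THE PRODUCT OF THE WEIGHTS OF A COMMON TOP PAIR** is the (2.142) size factor: `Λ_u·Λ′_v = (L^k/c_f)²·(L^{kD})⁻¹`.
[cite: Balaban1984PropagatorsII, (2.142) p.248, (2.81) p.237, bookkeeping] -/
theorem lam_mul_lam_of_top (cf : ℝ) (u : BondIdx (domT hN D hk)) (hu : (u.1.1 : ℕ) = k) (v : BondIdx (domT hN D' hk))
    (hv : (v.1.1 : ℕ) = k) :
    lam hN D hk cf u * lam hN D' hk cf v = ((((ℓ + 1 : ℕ) : ℝ)) ^ k / cf) ^ 2 * ((((ℓ + 1 : ℕ) : ℝ) ^ (d + 1)) ^ k)⁻¹ := by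
  rw [lam_eq_of_top hN hk D cf u hu, lam_eq_of_top hN hk D' cf v hv]
  exact Real.mul_self_sqrt (by positivity)

variable {cf : ℝ} (hcf : cf ≠ 0) {w : BondIdx (domT hN D hk) → ℝ} (hw : ∀ i, 0 < w i)
  {w' : BondIdx (domT hN D' hk) → ℝ} (hw' : ∀ i, 0 < w' i)

/-- `Q*e_i` is the weight function `q_i`, as a vector. [cite: Balaban1984PropagatorsII, (2.18) p.226, bookkeeping] -/
theorem QsE_single_eq (D₀ : TDomains d ℓ Mh k P' R) (i : BondIdx (domT hN D₀ hk)) :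
    QsE (domT hN D₀ hk) (EuclideanSpace.single i (1 : ℝ)) = WithLp.toLp 2 (qwt hN D₀ hk i) :=
  PiLp.ext fun f => by rw [QsE_single_apply, WithLp.ofLp_toLp]

/-- **THE TWO-FAMILY DIFFERENCE OF (2.142) AS ONE AVERAGE**: for common top `u, v`,
`X′(ũ, v) − X(u, v_D) = (Q[(G′ − G)q′_v])_u` (the averages `(Q·)_u`, `(Q·)_ũ` and the weights `q_{v_D}`, `q′_v` coincide).
[cite: Balaban1984PropagatorsII, (2.142) p.248, (2.20) p.226; Balaban1985BackgroundPropagators, Thm 3.14 p.427] -/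
theorem X_sub_X_eq (u : BondIdx (domT hN D hk)) (hu : IsCT hN D D' hk u.1) (v : BondIdx (domT hN D' hk)) (hv : IsCT hN D D' hk v.1) :
    X hN D' hk hcf hw' ⟨u.1, hu.2.2⟩ v - X hN D hk hcf hw u ⟨v.1, hv.2.1⟩
      = QE (domT hN D hk) (GE (domT hN D' hk) hcf hw' (WithLp.toLp 2 (qwt hN D' hk v))
          - GE (domT hN D hk) hcf hw (WithLp.toLp 2 (qwt hN D' hk v))) u := by
  unfold X
  rw [QsE_single_eq hN hk D' v, QsE_single_eq hN hk D ⟨v.1, hv.2.1⟩, qwt_twin' hN D D' hk v hv, map_sub, PiLp.sub_apply]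
  rfl

end Dictionary

/-! ## §2  Both index bonds fully inside `Ω`: the two-family bound of `G − G′` block by block -/

section Inside

variable (hN : ∀ μ, N0 ℓ Mh k P' μ = (PV d ℓ m K hd hL).sitesPerDir 0) (D D' : TDomains d ℓ Mh k P' R) (hk : k ≤ m + K)

/-- **A TUBE FULLY INSIDE `Ω`**: if both end-points of the index bond `u` (level `k`) lie in `Ω_k^{(k)}` of BOTH families, every site
of its tube has both levels `= k`. [cite: Balaban1984PropagatorsII, (2.1)–(2.3) p.224; Balaban1985BackgroundPropagators, p.426 («Ω = Ω_k ∩ Ω′_k»)] -/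
theorem levs_of_tube (D₀ D₁ : TDomains d ℓ Mh k P' R) (hk1 : 1 ≤ k) (u : BondIdx (domT hN D₀ hk)) (hu : (u.1.1 : ℕ) = k)
    (h₀s : u.1.2.src ∈ (domT hN D₀ hk).Om (lvl hN D₀ hk u)) (h₀t : u.1.2.tgt ∈ (domT hN D₀ hk).Om (lvl hN D₀ hk u))
    (h₁s : u.1.2.src ∈ (domT hN D₁ hk).Om (lvl hN D₀ hk u)) (h₁t : u.1.2.tgt ∈ (domT hN D₁ hk).Om (lvl hN D₀ hk u))
    {z : Site (PV d ℓ m K hd hL) 0}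
    (hz : iterBlockOf (lvl hN D₀ hk u) z = u.1.2.src ∨ iterBlockOf (lvl hN D₀ hk u) z = u.1.2.tgt) :
    D₀.lev (toBox hN z).1 = k ∧ D₁.lev (toBox hN z).1 = k := by
  have hj1 : 1 ≤ lvl hN D₀ hk u := one_le_lvl hN D₀ hk hk1 u
  have hjk : lvl hN D₀ hk u ≤ k := lvl_le hN D₀ hk u
  have hl₀ := D₀.lev_le (toBox hN z).1
  have hl₁ := D₁.lev_le (toBox hN z).1
  rcases hz with hz | hz
  · have h1 := le_lev_of_mem_Om hN hk D₀ hj1 hjk hz h₀s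
    have h2 := le_lev_of_mem_Om hN hk D₁ hj1 hjk hz h₁s
    change (u.1.1 : ℕ) ≤ _ at h1 h2
    constructor <;> omega
  · have h1 := le_lev_of_mem_Om hN hk D₀ hj1 hjk hz h₀t
    have h2 := le_lev_of_mem_Om hN hk D₁ hj1 hjk hz h₁t
    change (u.1.1 : ℕ) ≤ _ at h1 h2
    constructor <;> omega

variable {cf : ℝ} (hcf : cf ≠ 0) {w : BondIdx (domT hN D hk) → ℝ} (hw : ∀ i, 0 < w i)
  {w' : BondIdx (domT hN D' hk) → ℝ} (hw' : ∀ i, 0 < w' i)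

/-- pieces of `q′_v` off the blocks met by the tube of `v` vanish. [cite: Balaban1984PropagatorsI, (1.18) p.20, bookkeeping] -/
theorem blockPiece_qwt_eq_zero (v : BondIdx (domT hN D' hk)) {z : ↥(bset D'.toDomains)} (hz : z ∉ metBlocks hN D' hk v) :
    blockPiece (g := geomT D') (blkV1 hN D') z (qwt hN D' hk v) = 0 := by
  classical
  funext x
  simp only [blockPiece, Pi.zero_apply]
  split_ifs with h
  · by_contra hne
    apply hz
    obtain ⟨x', hx', t', ht', rfl⟩ := exists_of_qwt_ne_zero hN D' hk v hne
    rw [mem_iterBlock] at hx'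
    rw [← h]
    refine mem_metBlocks hN D' hk v ?_
    change iterBlockOf (lvl hN D' hk v) (runSite x' v.1.2.dir t') = _ ∨ iterBlockOf (lvl hN D' hk v) (runSite x' v.1.2.dir t') = _
    rcases iterBlockOf_runSite_mem (lvl_le_mK hN D' hk v) x' v.1.2.dir ht'.le with h1 | h1
    · exact Or.inl (h1.trans hx')
    · right; rw [h1, hx']; rfl
  · rfl

/-- **ONE CONTOUR BOND, BOTH TUBES INSIDE `Ω`**: from the two-family bound of `G[Ω] − G[Ω′]` between common top blocks (`hdiff`, the
conclusion shape of this seat's `B9Thm314GFlatV1Transfer.thm314_G_flat_V1`), for common top `u ∈ 𝔅[D]`, `v ∈ 𝔅[D′]` whose tubes lie in `Ω`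
and every fine bond `f` of the tube of `u`:
`|((G′ − G)q′_v)(f)| ≤ 2L^D·C·e^{6δ}·(L^k/c_f)²(L^{kD})⁻¹·e^{−δd(βu, β′v, Ω)}` (`q′_v` split over the `≤ 2L^D` blocks met by the tube of `v`,
each a common top block; `|q′_v| ≤ L^{−kD}`; tubes are `k`-close to the carrier blocks). [cite: Balaban1985BackgroundPropagators, Thm 3.14 (3.154) p.427; Balaban1984PropagatorsII, (2.142) p.248] -/
theorem contour_inside_le (hk1 : 1 ≤ k) (hRM : 2 ≤ R * Mh) (hMh : 1 ≤ Mh) (hP : ∀ μ, 1 ≤ P' μ) {C δ : ℝ} (hC : 0 ≤ C) (hδ : 0 ≤ δ)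
    (hdiff : ∀ (y : ↥(bset D.toDomains)) (hyD' : y.1 ∈ bset D'.toDomains) (y' : ↥(bset D'.toDomains))
        (hy'D : y'.1 ∈ bset D.toDomains), y.1.1 = k → y'.1.1 = k →
        ∀ (μ : PBond (PV d ℓ m K hd hL) 0 → ℝ) (B : ℝ), BlockSupp (g := geomT D') (blkV1 hN D') μ y' B →
        ∀ x : PBond (PV d ℓ m K hd hL) 0, blkV1 hN D x = y →
          |onFun (GE (domT hN D hk) hcf hw) μ x - onFun (GE (domT hN D' hk) hcf hw') μ x|
            ≤ C * (pref cf y * B)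
              * Real.exp (-(δ * min ((geomT D).dist y ⟨y'.1, hy'D⟩) ((geomT D').dist ⟨y.1, hyD'⟩ y')))
              * Real.exp (-(δ * dOmega D D' y.1.2 y'.1.2)))
    (u : BondIdx (domT hN D hk)) (hu : IsCT hN D D' hk u.1)
    (hus : u.1.2.src ∈ (domT hN D hk).Om (lvl hN D hk u)) (hut : u.1.2.tgt ∈ (domT hN D hk).Om (lvl hN D hk u))
    (hus' : u.1.2.src ∈ (domT hN D' hk).Om (lvl hN D hk u)) (hut' : u.1.2.tgt ∈ (domT hN D' hk).Om (lvl hN D hk u))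
    (v : BondIdx (domT hN D' hk)) (hv : IsCT hN D D' hk v.1)
    (hvs : v.1.2.src ∈ (domT hN D' hk).Om (lvl hN D' hk v)) (hvt : v.1.2.tgt ∈ (domT hN D' hk).Om (lvl hN D' hk v))
    (hvs' : v.1.2.src ∈ (domT hN D hk).Om (lvl hN D' hk v)) (hvt' : v.1.2.tgt ∈ (domT hN D hk).Om (lvl hN D' hk v))
    {f : PBond (PV d ℓ m K hd hL) 0}
    (hf : iterBlockOf (lvl hN D hk u) f.src = u.1.2.src ∨ iterBlockOf (lvl hN D hk u) f.src = u.1.2.tgt) :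
    |onFun (GE (domT hN D' hk) hcf hw') (qwt hN D' hk v) f - onFun (GE (domT hN D hk) hcf hw) (qwt hN D' hk v) f|
      ≤ 2 * (((ℓ + 1 : ℕ) : ℝ)) ^ (d + 1) * C * Real.exp (6 * δ)
          * (((((ℓ + 1 : ℕ) : ℝ)) ^ k / cf) ^ 2 * ((((ℓ + 1 : ℕ) : ℝ) ^ (d + 1)) ^ k)⁻¹)
          * Real.exp (-(δ * dOmega D D' (β hN D hk u).1.2 (β hN D' hk v).1.2)) := by
  classical
  have hdT := B6Prop23MultiLevelTorus.isPseudoDist_distT D hMh hP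
  have hdT' := B6Prop23MultiLevelTorus.isPseudoDist_distT D' hMh hP
  set q := qwt hN D' hk v with hq
  set T : Module.End ℝ (PBond (PV d ℓ m K hd hL) 0 → ℝ) :=
    onFun (GE (domT hN D' hk) hcf hw') - onFun (GE (domT hN D hk) hcf hw) with hT
  -- the output block `y = y(f)` is a common top block, `k`-close to `β u`
  obtain ⟨hDf, hD'f⟩ := levs_of_tube hN hk D D' hk1 u hu.1 hus hut hus' hut' hf
  obtain ⟨hy, hyD', hylab⟩ := common_top_of_levs D D' (toBox hN f.src) hDf hD'f
  have hyu : tdistK (ℓ := ℓ) (Mh := Mh) (k := k) (P := P') (β hN D hk u).1.2 (blkV1 hN D f).1.2 ≤ 3 := by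
    rw [tdistK_comm]
    change tdistK (ℓ := ℓ) (Mh := Mh) (k := k) (P := P') (blkOf D.toDomains (toBox hN f.src)).1.2 _ ≤ 3
    rw [hylab]
    exact tdistK_tube_beta_le hN hk D hk1 u hu.1 hf
  -- the size of `q′_v`
  set B : ℝ := ((((ℓ + 1 : ℕ) : ℝ) ^ (d + 1)) ^ k)⁻¹ with hB
  have hB0 : 0 ≤ B := by positivity
  have hqB : ∀ x, |q x| ≤ B := fun x => by
    rw [abs_of_nonneg (qwt_nonneg hN D' hk v x)]
    have h := qwt_le hN D' hk v x
    have e : lvl hN D' hk v = k := hv.1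
    rw [e] at h
    exact h
  -- the constant per block
  set W : ℝ := (((((ℓ + 1 : ℕ) : ℝ)) ^ k / cf) ^ 2 * ((((ℓ + 1 : ℕ) : ℝ) ^ (d + 1)) ^ k)⁻¹) with hW
  have hpref : pref cf (blkV1 hN D f) * B = W := by
    change ((((ℓ + 1 : ℕ) : ℝ)) ^ (blkV1 hN D f).1.1 / cf) ^ 2 * B = W
    rw [show (blkV1 hN D f).1.1 = k from hy]
  -- each piece
  have hpiece : ∀ z ∈ metBlocks hN D' hk v,
      |T (blockPiece (g := geomT D') (blkV1 hN D') z q) f|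
        ≤ C * W * (Real.exp (6 * δ) * Real.exp (-(δ * dOmega D D' (β hN D hk u).1.2 (β hN D' hk v).1.2))) := by
    intro z hz
    obtain ⟨z₀, hz₀, rfl⟩ := exists_of_mem_metBlocks hN D' hk v hz
    obtain ⟨hD'z, hDz⟩ := levs_of_tube hN hk D' D hk1 v hv.1 hvs hvt hvs' hvt' hz₀
    obtain ⟨hzk, hzD, hzlab⟩ := common_top_of_levs D' D (toBox hN z₀) hD'z hDz
    have hsupp := blockSupp_blockPiece (g := geomT D') (blkV1 hN D') q (blkOf D'.toDomains (toBox hN z₀)) B hB0 (fun x _ => hqB x)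
    have h := hdiff (blkV1 hN D f) hyD' (blkOf D'.toDomains (toBox hN z₀)) hzD hy hzk _ B hsupp f rfl
    have hTapp : T (blockPiece (g := geomT D') (blkV1 hN D') (blkOf D'.toDomains (toBox hN z₀)) q) f
        = onFun (GE (domT hN D' hk) hcf hw') (blockPiece (g := geomT D') (blkV1 hN D') (blkOf D'.toDomains (toBox hN z₀)) q) f
          - onFun (GE (domT hN D hk) hcf hw) (blockPiece (g := geomT D') (blkV1 hN D') (blkOf D'.toDomains (toBox hN z₀)) q) f := by
      rw [hT, LinearMap.sub_apply, Pi.sub_apply]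
    rw [hTapp, abs_sub_comm]
    refine h.trans ?_
    -- `e^{−δ min} ≤ 1`, `pref·B = W`, and the (3.154) chain through `y(f)` and the block of `z₀`
    have hmin : Real.exp (-(δ * min ((geomT D).dist (blkV1 hN D f) ⟨(blkOf D'.toDomains (toBox hN z₀)).1, hzD⟩)
        ((geomT D').dist ⟨(blkV1 hN D f).1, hyD'⟩ (blkOf D'.toDomains (toBox hN z₀))))) ≤ 1 := by
      rw [Real.exp_le_one_iff]
      have h1 := hdT.nonneg (blkV1 hN D f) ⟨(blkOf D'.toDomains (toBox hN z₀)).1, hzD⟩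
      have h2 := hdT'.nonneg ⟨(blkV1 hN D f).1, hyD'⟩ (blkOf D'.toDomains (toBox hN z₀))
      have := le_min h1 h2
      nlinarith
    have hzv : tdistK (ℓ := ℓ) (Mh := Mh) (k := k) (P := P') (blkOf D'.toDomains (toBox hN z₀)).1.2 (β hN D' hk v).1.2 ≤ 3 := by
      rw [hzlab]
      exact tdistK_tube_beta_le hN hk D' hk1 v hv.1 hz₀
    have hΩ : dOmega D D' (β hN D hk u).1.2 (β hN D' hk v).1.2
        ≤ dOmega D D' (blkV1 hN D f).1.2 (blkOf D'.toDomains (toBox hN z₀)).1.2 + 6 := by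
      have h1 := dOmega_le_tdistK_add D D' (β hN D hk u).1.2 (blkV1 hN D f).1.2 (β hN D' hk v).1.2
      have h2 := dOmega_le_add_tdistK D D' (blkV1 hN D f).1.2 (blkOf D'.toDomains (toBox hN z₀)).1.2 (β hN D' hk v).1.2
      linarith
    have hexp : Real.exp (-(δ * dOmega D D' (blkV1 hN D f).1.2 (blkOf D'.toDomains (toBox hN z₀)).1.2))
        ≤ Real.exp (6 * δ) * Real.exp (-(δ * dOmega D D' (β hN D hk u).1.2 (β hN D' hk v).1.2)) := by
      rw [← Real.exp_add, Real.exp_le_exp]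
      nlinarith [mul_le_mul_of_nonneg_left hΩ hδ]
    have hCW : 0 ≤ C * W := by positivity
    calc C * (pref cf (blkV1 hN D f) * B)
          * Real.exp (-(δ * min ((geomT D).dist (blkV1 hN D f) ⟨(blkOf D'.toDomains (toBox hN z₀)).1, hzD⟩)
              ((geomT D').dist ⟨(blkV1 hN D f).1, hyD'⟩ (blkOf D'.toDomains (toBox hN z₀)))))
          * Real.exp (-(δ * dOmega D D' (blkV1 hN D f).1.2 (blkOf D'.toDomains (toBox hN z₀)).1.2))
        ≤ C * W * 1 * (Real.exp (6 * δ) * Real.exp (-(δ * dOmega D D' (β hN D hk u).1.2 (β hN D' hk v).1.2))) := by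
          rw [hpref]
          exact mul_le_mul (mul_le_mul_of_nonneg_left hmin hCW) hexp (Real.exp_pos _).le (by positivity)
      _ = _ := by ring
  -- the decomposition over the met blocks
  have hdec : T q f = ∑ z, T (blockPiece (g := geomT D') (blkV1 hN D') z q) f := by
    conv_lhs => rw [← sum_blockPiece (g := geomT D') (blkV1 hN D') q]
    rw [map_sum, Finset.sum_apply]
  have hTq : onFun (GE (domT hN D' hk) hcf hw') q f - onFun (GE (domT hN D hk) hcf hw) q f = T q f := by
    rw [hT, LinearMap.sub_apply, Pi.sub_apply]
  have hcard : ((metBlocks hN D' hk v).card : ℝ) ≤ 2 * (((ℓ + 1 : ℕ) : ℝ)) ^ (d + 1) := by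
    exact_mod_cast card_metBlocks_le hN D' hk hk1 hRM v
  have hK0 : 0 ≤ C * W * (Real.exp (6 * δ) * Real.exp (-(δ * dOmega D D' (β hN D hk u).1.2 (β hN D' hk v).1.2))) := by
    positivity
  rw [hTq, hdec]
  calc |∑ z, T (blockPiece (g := geomT D') (blkV1 hN D') z q) f|
      ≤ ∑ z, |T (blockPiece (g := geomT D') (blkV1 hN D') z q) f| := Finset.abs_sum_le_sum_abs _ _
    _ = ∑ z ∈ metBlocks hN D' hk v, |T (blockPiece (g := geomT D') (blkV1 hN D') z q) f| := by
        refine (Finset.sum_subset (Finset.subset_univ (metBlocks hN D' hk v)) fun z _ hz => ?_).symm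
        rw [blockPiece_qwt_eq_zero hN D' hk v hz, map_zero, Pi.zero_apply, abs_zero]
    _ ≤ ∑ z ∈ metBlocks hN D' hk v, C * W * (Real.exp (6 * δ) * Real.exp (-(δ * dOmega D D' (β hN D hk u).1.2 (β hN D' hk v).1.2))) :=
        Finset.sum_le_sum hpiece
    _ = (metBlocks hN D' hk v).card * (C * W * (Real.exp (6 * δ) * Real.exp (-(δ * dOmega D D' (β hN D hk u).1.2 (β hN D' hk v).1.2)))) := by
        rw [Finset.sum_const, nsmul_eq_mul]
    _ ≤ (2 * (((ℓ + 1 : ℕ) : ℝ)) ^ (d + 1)) * (C * W * (Real.exp (6 * δ) * Real.exp (-(δ * dOmega D D' (β hN D hk u).1.2 (β hN D' hk v).1.2)))) :=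
        mul_le_mul_of_nonneg_right hcard hK0
    _ = _ := by rw [hW]; ring

/-- **(2.142) TWO-FAMILY, BOTH TUBES INSIDE `Ω`**: `|X′(ũ, v) − X(u, v_D)| ≤ 2L^D·C·e^{6δ}·Λ_uΛ′_v·e^{−δd(βu, β′v, Ω)}` (the average of
`contour_inside_le` over the contours of `u`; `Λ_uΛ′_v = (L^k/c_f)²(L^{kD})⁻¹`).
[cite: Balaban1985BackgroundPropagators, Thm 3.14 (3.154) p.427; Balaban1984PropagatorsII, (2.142) p.248] -/
theorem X_sub_X_inside_le (hk1 : 1 ≤ k) (hRM : 2 ≤ R * Mh) (hMh : 1 ≤ Mh) (hP : ∀ μ, 1 ≤ P' μ) {C δ : ℝ} (hC : 0 ≤ C) (hδ : 0 ≤ δ)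
    (hdiff : ∀ (y : ↥(bset D.toDomains)) (hyD' : y.1 ∈ bset D'.toDomains) (y' : ↥(bset D'.toDomains))
        (hy'D : y'.1 ∈ bset D.toDomains), y.1.1 = k → y'.1.1 = k →
        ∀ (μ : PBond (PV d ℓ m K hd hL) 0 → ℝ) (B : ℝ), BlockSupp (g := geomT D') (blkV1 hN D') μ y' B →
        ∀ x : PBond (PV d ℓ m K hd hL) 0, blkV1 hN D x = y →
          |onFun (GE (domT hN D hk) hcf hw) μ x - onFun (GE (domT hN D' hk) hcf hw') μ x|
            ≤ C * (pref cf y * B)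
              * Real.exp (-(δ * min ((geomT D).dist y ⟨y'.1, hy'D⟩) ((geomT D').dist ⟨y.1, hyD'⟩ y')))
              * Real.exp (-(δ * dOmega D D' y.1.2 y'.1.2)))
    (u : BondIdx (domT hN D hk)) (hu : IsCT hN D D' hk u.1)
    (hus : u.1.2.src ∈ (domT hN D hk).Om (lvl hN D hk u)) (hut : u.1.2.tgt ∈ (domT hN D hk).Om (lvl hN D hk u))
    (hus' : u.1.2.src ∈ (domT hN D' hk).Om (lvl hN D hk u)) (hut' : u.1.2.tgt ∈ (domT hN D' hk).Om (lvl hN D hk u))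
    (v : BondIdx (domT hN D' hk)) (hv : IsCT hN D D' hk v.1)
    (hvs : v.1.2.src ∈ (domT hN D' hk).Om (lvl hN D' hk v)) (hvt : v.1.2.tgt ∈ (domT hN D' hk).Om (lvl hN D' hk v))
    (hvs' : v.1.2.src ∈ (domT hN D hk).Om (lvl hN D' hk v)) (hvt' : v.1.2.tgt ∈ (domT hN D hk).Om (lvl hN D' hk v)) :
    |X hN D' hk hcf hw' ⟨u.1, hu.2.2⟩ v - X hN D hk hcf hw u ⟨v.1, hv.2.1⟩|
      ≤ 2 * (((ℓ + 1 : ℕ) : ℝ)) ^ (d + 1) * C * Real.exp (6 * δ) * (lam hN D hk cf u * lam hN D' hk cf v)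
          * Real.exp (-(δ * dOmega D D' (β hN D hk u).1.2 (β hN D' hk v).1.2)) := by
  rw [X_sub_X_eq hN D D' hk hcf hw hw' u hu v hv, lam_mul_lam_of_top hN D D' hk cf u hu.1 v hv.1]
  refine abs_QE_apply_le hN D hk u _ fun x hx t ht => ?_
  rw [mem_iterBlock] at hx
  have hf : iterBlockOf (lvl hN D hk u) (runBond x u.1.2.dir t).src = u.1.2.src
      ∨ iterBlockOf (lvl hN D hk u) (runBond x u.1.2.dir t).src = u.1.2.tgt := by
    change iterBlockOf (lvl hN D hk u) (runSite x u.1.2.dir t) = _ ∨ iterBlockOf (lvl hN D hk u) (runSite x u.1.2.dir t) = _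
    rcases iterBlockOf_runSite_mem (lvl_le_mK hN D hk u) x u.1.2.dir ht.le with h | h
    · exact Or.inl (h.trans hx)
    · right; rw [h, hx]; rfl
  rw [PiLp.sub_apply]
  exact contour_inside_le hN D D' hk hcf hw hw' hk1 hRM hMh hP hC hδ hdiff u hu hus hut hus' hut' v hv hvs hvt hvs' hvt' hf

end Inside

/-! ## §3  An index bond touching `Ωᶜ`: the trivial bound already carries the (3.154) factor -/

section Outside

variable (hN : ∀ μ, N0 ℓ Mh k P' μ = (PV d ℓ m K hd hL).sitesPerDir 0) (D D' : TDomains d ℓ Mh k P' R) (hk : k ≤ m + K)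

/-- **A TUBE NOT INSIDE `Ω` MEETS `Ωᶜ`**: if an end-point of the top index bond `u ∈ 𝔅[D₀]` is outside `Ω_k^{(k)}` of one of the two families,
some site `z` of the tube of `u` has not both levels `= k`. [cite: Balaban1985BackgroundPropagators, Thm 3.14 p.427 («at least one localization X_i intersects Ωᶜ»); Balaban1984PropagatorsII, (2.1)–(2.3) p.224] -/
theorem exists_bad_site_of_not_inside (D₀ D₁ : TDomains d ℓ Mh k P' R) (hk1 : 1 ≤ k) (u : BondIdx (domT hN D₀ hk)) (hu : (u.1.1 : ℕ) = k)
    (h : ¬ ((u.1.2.src ∈ (domT hN D₀ hk).Om (lvl hN D₀ hk u) ∧ u.1.2.src ∈ (domT hN D₁ hk).Om (lvl hN D₀ hk u)) ∧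
      (u.1.2.tgt ∈ (domT hN D₀ hk).Om (lvl hN D₀ hk u) ∧ u.1.2.tgt ∈ (domT hN D₁ hk).Om (lvl hN D₀ hk u)))) :
    ∃ z : Site (PV d ℓ m K hd hL) 0,
      (iterBlockOf (lvl hN D₀ hk u) z = u.1.2.src ∨ iterBlockOf (lvl hN D₀ hk u) z = u.1.2.tgt) ∧
      ¬ (D₀.lev (toBox hN z).1 = k ∧ D₁.lev (toBox hN z).1 = k) := by
  have hj1 : 1 ≤ lvl hN D₀ hk u := one_le_lvl hN D₀ hk hk1 u
  have hjk : lvl hN D₀ hk u ≤ k := lvl_le hN D₀ hk u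
  have hjk' : lvl hN D₀ hk u = k := hu
  -- the witness at an end-point `e`
  have key : ∀ e : Site (PV d ℓ m K hd hL) (lvl hN D₀ hk u), (e = u.1.2.src ∨ e = u.1.2.tgt) →
      ¬ (e ∈ (domT hN D₀ hk).Om (lvl hN D₀ hk u) ∧ e ∈ (domT hN D₁ hk).Om (lvl hN D₀ hk u)) →
      ∃ z : Site (PV d ℓ m K hd hL) 0,
        (iterBlockOf (lvl hN D₀ hk u) z = u.1.2.src ∨ iterBlockOf (lvl hN D₀ hk u) z = u.1.2.tgt) ∧
        ¬ (D₀.lev (toBox hN z).1 = k ∧ D₁.lev (toBox hN z).1 = k) := by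
    intro e he hne
    obtain ⟨z, hz⟩ := iterBlock_nonempty (P := PV d ℓ m K hd hL) (lvl_le_mK hN D₀ hk u) e
    rw [mem_iterBlock] at hz
    refine ⟨z, ?_, fun hh => hne ?_⟩
    · rcases he with he | he
      · exact Or.inl (hz.trans he)
      · exact Or.inr (hz.trans he)
    · constructor
      · have h0 := (iterBlockOf_mem_domT_iff hN D₀ hk hj1 hjk z).2 (by rw [hh.1]; exact hjk)
        rwa [hz] at h0
      · have h0 := (iterBlockOf_mem_domT_iff hN D₁ hk hj1 hjk z).2 (by rw [hh.2]; exact hjk)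
        rwa [hz] at h0
  rcases not_and_or.1 h with h1 | h1
  · exact key _ (Or.inl rfl) h1
  · exact key _ (Or.inr rfl) h1

omit hd hL in
/-- **A WITNESS `k`-CLOSE TO ONE OF THE TWO CARRIER BLOCKS**: if `w ∈ Ωᶜ ∩ T^{(k)}` is within `3` of `a` or of `b` on `T^{(k)}`, then
`d(a, b, Ω) ≤ |a − b| + 6`. [cite: Balaban1985BackgroundPropagators, (3.154) p.427, bookkeeping] -/
theorem dOmega_le_tdistK_add_six {w a b : Fin (d + 1) → ℤ} (hw : w ∈ OmegaC D D')
    (h : tdistK (ℓ := ℓ) (Mh := Mh) (k := k) (P := P') w a ≤ 3 ∨ tdistK (ℓ := ℓ) (Mh := Mh) (k := k) (P := P') w b ≤ 3) :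
    dOmega D D' a b ≤ tdistK (ℓ := ℓ) (Mh := Mh) (k := k) (P := P') a b + 6 := by
  have h0 := dOmega_le D D' (β := a) (β' := b) hw
  have h1 := tdistK_triangle (ℓ := ℓ) (Mh := Mh) (k := k) (P := P') w a b
  have h2 := tdistK_triangle (ℓ := ℓ) (Mh := Mh) (k := k) (P := P') a b w
  have h3 := tdistK_comm (ℓ := ℓ) (Mh := Mh) (k := k) (P := P') a w
  have h4 := tdistK_comm (ℓ := ℓ) (Mh := Mh) (k := k) (P := P') b w
  have h5 := tdistK_nonneg (ℓ := ℓ) (Mh := Mh) (k := k) (P := P') w a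
  have h6 := tdistK_nonneg (ℓ := ℓ) (Mh := Mh) (k := k) (P := P') w b
  rcases h with h | h <;> linarith

variable {cf : ℝ} (hcf : cf ≠ 0) {w : BondIdx (domT hN D hk) → ℝ} (hw : ∀ i, 0 < w i)
  {w' : BondIdx (domT hN D' hk) → ℝ} (hw' : ∀ i, 0 < w' i)

/-- **(2.142) TWO-FAMILY WHEN ONE TUBE TOUCHES `Ωᶜ`**: from the one-family (2.142) bounds in the flat form
`|X(a,b)| ≤ A′Λ_aΛ_be^{−δρ(a,b)}` (both families), if the tube of `u` or of `v` is not inside `Ω` then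
`|X′(ũ, v) − X(u, v_D)| ≤ 2A′e^{9δ}·Λ_uΛ′_v·e^{−δd(βu, β′v, Ω)}` (the witness is within `3` of a carrier block on `T^{(k)}`, so
`d(βu, β′v, Ω) ≤ ρ + 9` for both families' `ρ`). [cite: Balaban1985BackgroundPropagators, Thm 3.14 (3.154) p.427; Balaban1984PropagatorsII, (2.142) p.248] -/
theorem X_sub_X_outside_le (hk1 : 1 ≤ k) (hMh : 1 ≤ Mh) (hP : ∀ μ, 1 ≤ P' μ) {A' δ : ℝ} (hA' : 0 ≤ A') (hδ : 0 ≤ δ)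
    (hXf : ∀ a b : BondIdx (domT hN D hk), |X hN D hk hcf hw a b|
      ≤ A' * (lam hN D hk cf a * lam hN D hk cf b) * Real.exp (-(δ * rho hN D hk a b)))
    (hXf' : ∀ a b : BondIdx (domT hN D' hk), |X hN D' hk hcf hw' a b|
      ≤ A' * (lam hN D' hk cf a * lam hN D' hk cf b) * Real.exp (-(δ * rho hN D' hk a b)))
    (u : BondIdx (domT hN D hk)) (hu : IsCT hN D D' hk u.1) (v : BondIdx (domT hN D' hk)) (hv : IsCT hN D D' hk v.1)
    (hout : ¬ ((u.1.2.src ∈ (domT hN D hk).Om (lvl hN D hk u) ∧ u.1.2.src ∈ (domT hN D' hk).Om (lvl hN D hk u)) ∧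
        (u.1.2.tgt ∈ (domT hN D hk).Om (lvl hN D hk u) ∧ u.1.2.tgt ∈ (domT hN D' hk).Om (lvl hN D hk u)))
      ∨ ¬ ((v.1.2.src ∈ (domT hN D' hk).Om (lvl hN D' hk v) ∧ v.1.2.src ∈ (domT hN D hk).Om (lvl hN D' hk v)) ∧
        (v.1.2.tgt ∈ (domT hN D' hk).Om (lvl hN D' hk v) ∧ v.1.2.tgt ∈ (domT hN D hk).Om (lvl hN D' hk v)))) :
    |X hN D' hk hcf hw' ⟨u.1, hu.2.2⟩ v - X hN D hk hcf hw u ⟨v.1, hv.2.1⟩|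
      ≤ 2 * A' * Real.exp (9 * δ) * (lam hN D hk cf u * lam hN D' hk cf v)
          * Real.exp (-(δ * dOmega D D' (β hN D hk u).1.2 (β hN D' hk v).1.2)) := by
  -- a witness within `3` of `β u` or of `β′ v`
  have hwit : ∃ wl : Fin (d + 1) → ℤ, wl ∈ OmegaC D D' ∧
      (tdistK (ℓ := ℓ) (Mh := Mh) (k := k) (P := P') wl (β hN D hk u).1.2 ≤ 3 ∨
        tdistK (ℓ := ℓ) (Mh := Mh) (k := k) (P := P') wl (β hN D' hk v).1.2 ≤ 3) := by
    rcases hout with h | h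
    · obtain ⟨z, hz, hbad⟩ := exists_bad_site_of_not_inside hN hk D D' hk1 u hu.1 h
      exact ⟨_, blk_mem_OmegaC D D' (x := toBox hN z) hbad, Or.inl (tdistK_tube_beta_le hN hk D hk1 u hu.1 hz)⟩
    · obtain ⟨z, hz, hbad⟩ := exists_bad_site_of_not_inside hN hk D' D hk1 v hv.1 h
      exact ⟨_, blk_mem_OmegaC D D' (x := toBox hN z) (fun hh => hbad ⟨hh.2, hh.1⟩),
        Or.inr (tdistK_tube_beta_le hN hk D' hk1 v hv.1 hz)⟩
  obtain ⟨wl, hwl, hnear⟩ := hwit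
  have hΩ := dOmega_le_tdistK_add_six D D' hwl hnear
  -- `|βu − β′v| ≤ ρ(u, v_D) + 3` and `≤ ρ′(ũ, v) + 3`
  have hρ : tdistK (ℓ := ℓ) (Mh := Mh) (k := k) (P := P') (β hN D hk u).1.2 (β hN D' hk v).1.2 ≤ rho hN D hk u ⟨v.1, hv.2.1⟩ + 3 := by
    have h1 := tdistK_triangle (ℓ := ℓ) (Mh := Mh) (k := k) (P := P') (β hN D hk u).1.2 (β hN D hk ⟨v.1, hv.2.1⟩).1.2 (β hN D' hk v).1.2
    have h2 := tdistK_le_rho_of_top hN hk D hMh hP hk1 u ⟨v.1, hv.2.1⟩ hu.1 hv.1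
    have h3 := tdistK_twin_le' hN D D' hk v hv hk1
    linarith
  have hρ' : tdistK (ℓ := ℓ) (Mh := Mh) (k := k) (P := P') (β hN D hk u).1.2 (β hN D' hk v).1.2 ≤ rho hN D' hk ⟨u.1, hu.2.2⟩ v + 3 := by
    have h1 := tdistK_triangle (ℓ := ℓ) (Mh := Mh) (k := k) (P := P') (β hN D hk u).1.2 (β hN D' hk ⟨u.1, hu.2.2⟩).1.2 (β hN D' hk v).1.2
    have h2 := tdistK_le_rho_of_top hN hk D' hMh hP hk1 ⟨u.1, hu.2.2⟩ v hu.1 hv.1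
    have h3 := tdistK_twin_le hN D D' hk u hu hk1
    linarith
  have hlu := lam_pos hN D hk hcf u
  have hlv := lam_pos hN D' hk hcf v
  have ha := hXf' ⟨u.1, hu.2.2⟩ v
  have hb := hXf u ⟨v.1, hv.2.1⟩
  rw [lam_twin hN D D' hk cf u hu] at ha
  rw [lam_twin' hN D D' hk cf v hv] at hb
  have hea : Real.exp (-(δ * rho hN D' hk ⟨u.1, hu.2.2⟩ v))
      ≤ Real.exp (9 * δ) * Real.exp (-(δ * dOmega D D' (β hN D hk u).1.2 (β hN D' hk v).1.2)) := by
    rw [← Real.exp_add, Real.exp_le_exp]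
    nlinarith [mul_le_mul_of_nonneg_left (hΩ.trans (by linarith : _ ≤ rho hN D' hk ⟨u.1, hu.2.2⟩ v + 3 + 6)) hδ]
  have heb : Real.exp (-(δ * rho hN D hk u ⟨v.1, hv.2.1⟩))
      ≤ Real.exp (9 * δ) * Real.exp (-(δ * dOmega D D' (β hN D hk u).1.2 (β hN D' hk v).1.2)) := by
    rw [← Real.exp_add, Real.exp_le_exp]
    nlinarith [mul_le_mul_of_nonneg_left (hΩ.trans (by linarith : _ ≤ rho hN D hk u ⟨v.1, hv.2.1⟩ + 3 + 6)) hδ]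
  have hF : 0 ≤ A' * (lam hN D hk cf u * lam hN D' hk cf v) := mul_nonneg hA' (mul_pos hlu hlv).le
  calc |X hN D' hk hcf hw' ⟨u.1, hu.2.2⟩ v - X hN D hk hcf hw u ⟨v.1, hv.2.1⟩|
      ≤ |X hN D' hk hcf hw' ⟨u.1, hu.2.2⟩ v| + |X hN D hk hcf hw u ⟨v.1, hv.2.1⟩| := abs_sub _ _
    _ ≤ A' * (lam hN D hk cf u * lam hN D' hk cf v)
          * (Real.exp (9 * δ) * Real.exp (-(δ * dOmega D D' (β hN D hk u).1.2 (β hN D' hk v).1.2)))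
        + A' * (lam hN D hk cf u * lam hN D' hk cf v)
          * (Real.exp (9 * δ) * Real.exp (-(δ * dOmega D D' (β hN D hk u).1.2 (β hN D' hk v).1.2))) :=
        add_le_add (ha.trans (mul_le_mul_of_nonneg_left hea hF)) (hb.trans (mul_le_mul_of_nonneg_left heb hF))
    _ = _ := by ring

end Outside

/-! ## §4  THEOREM 3.14 AT `U = 1` FOR THE KERNEL (2.142) OF `QGQ*`: the two cases combined -/

section Main

variable (hN : ∀ μ, N0 ℓ Mh k P' μ = (PV d ℓ m K hd hL).sitesPerDir 0) (D D' : TDomains d ℓ Mh k P' R) (hk : k ≤ m + K)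
variable {cf : ℝ} (hcf : cf ≠ 0) {w : BondIdx (domT hN D hk) → ℝ} (hw : ∀ i, 0 < w i)
  {w' : BondIdx (domT hN D' hk) → ℝ} (hw' : ∀ i, 0 < w' i)

/-- **THEOREM 3.14 (3.154) AT `U = 1` FOR `QGQ*` ((2.142) TWO-FAMILY), HYPOTHESIS-LEVEL**: given the two-family bound of `G[Ω] − G[Ω′]`
between common top blocks (`hdiff`: the literal conclusion shape of `B9Thm314GFlatV1Transfer.thm314_G_flat_V1`) and the one-family (2.142)
bounds in the flat form `|X(a,b)| ≤ A′Λ_aΛ_be^{−δρ(a,b)}` for both families, for every pair of COMMON TOP index bonds `u ∈ 𝔅[D]`, `v ∈ 𝔅[D′]`: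
`|X′(ũ, v) − X(u, v_D)| ≤ (2L^D·C·e^{6δ} + 2A′e^{9δ})·Λ_uΛ′_v·e^{−δ·d(βu, β′v, Ω)}` — print's (2.142) «|(QGQ*)(b,b′)| ≤ O(1)(L^jη)²(L^{j′}η)^{−d}…»
for the DIFFERENCE of the two kernels «with the additional factor exp(−δ₀d(y,y′,Ω))», `Λ_uΛ′_v = (L^k/c_f)²(L^{kD})⁻¹`, the plain decay being
kept separately by the one-family bounds (the input `hΔ` of `B9Thm314QGQInvFlatV1Transfer.term_le`).
[cite: Balaban1985BackgroundPropagators, Thm 3.14 (3.154) pp.426–427; Balaban1984PropagatorsII, (2.142) p.248] -/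
theorem thm314_QGQ_flat_of_hyps (hk1 : 1 ≤ k) (hRM : 2 ≤ R * Mh) (hMh : 1 ≤ Mh) (hP : ∀ μ, 1 ≤ P' μ) {C A' δ : ℝ}
    (hC : 0 ≤ C) (hA' : 0 ≤ A') (hδ : 0 ≤ δ)
    (hdiff : ∀ (y : ↥(bset D.toDomains)) (hyD' : y.1 ∈ bset D'.toDomains) (y' : ↥(bset D'.toDomains))
        (hy'D : y'.1 ∈ bset D.toDomains), y.1.1 = k → y'.1.1 = k →
        ∀ (μ : PBond (PV d ℓ m K hd hL) 0 → ℝ) (B : ℝ), BlockSupp (g := geomT D') (blkV1 hN D') μ y' B →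
        ∀ x : PBond (PV d ℓ m K hd hL) 0, blkV1 hN D x = y →
          |onFun (GE (domT hN D hk) hcf hw) μ x - onFun (GE (domT hN D' hk) hcf hw') μ x|
            ≤ C * (pref cf y * B)
              * Real.exp (-(δ * min ((geomT D).dist y ⟨y'.1, hy'D⟩) ((geomT D').dist ⟨y.1, hyD'⟩ y')))
              * Real.exp (-(δ * dOmega D D' y.1.2 y'.1.2)))
    (hXf : ∀ a b : BondIdx (domT hN D hk), |X hN D hk hcf hw a b|
      ≤ A' * (lam hN D hk cf a * lam hN D hk cf b) * Real.exp (-(δ * rho hN D hk a b)))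
    (hXf' : ∀ a b : BondIdx (domT hN D' hk), |X hN D' hk hcf hw' a b|
      ≤ A' * (lam hN D' hk cf a * lam hN D' hk cf b) * Real.exp (-(δ * rho hN D' hk a b)))
    (u : BondIdx (domT hN D hk)) (hu : IsCT hN D D' hk u.1) (v : BondIdx (domT hN D' hk)) (hv : IsCT hN D D' hk v.1) :
    |X hN D' hk hcf hw' ⟨u.1, hu.2.2⟩ v - X hN D hk hcf hw u ⟨v.1, hv.2.1⟩|
      ≤ (2 * (((ℓ + 1 : ℕ) : ℝ)) ^ (d + 1) * C * Real.exp (6 * δ) + 2 * A' * Real.exp (9 * δ))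
          * (lam hN D hk cf u * lam hN D' hk cf v)
          * Real.exp (-(δ * dOmega D D' (β hN D hk u).1.2 (β hN D' hk v).1.2)) := by
  have hlu := lam_pos hN D hk hcf u
  have hlv := lam_pos hN D' hk hcf v
  have hZ : 0 ≤ (lam hN D hk cf u * lam hN D' hk cf v)
      * Real.exp (-(δ * dOmega D D' (β hN D hk u).1.2 (β hN D' hk v).1.2)) := by positivity
  have hK1 : 0 ≤ 2 * (((ℓ + 1 : ℕ) : ℝ)) ^ (d + 1) * C * Real.exp (6 * δ) := by positivity
  have hK2 : 0 ≤ 2 * A' * Real.exp (9 * δ) := by positivity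
  rcases Classical.em (((u.1.2.src ∈ (domT hN D hk).Om (lvl hN D hk u) ∧ u.1.2.src ∈ (domT hN D' hk).Om (lvl hN D hk u)) ∧
        (u.1.2.tgt ∈ (domT hN D hk).Om (lvl hN D hk u) ∧ u.1.2.tgt ∈ (domT hN D' hk).Om (lvl hN D hk u)))
      ∧ ((v.1.2.src ∈ (domT hN D' hk).Om (lvl hN D' hk v) ∧ v.1.2.src ∈ (domT hN D hk).Om (lvl hN D' hk v)) ∧
        (v.1.2.tgt ∈ (domT hN D' hk).Om (lvl hN D' hk v) ∧ v.1.2.tgt ∈ (domT hN D hk).Om (lvl hN D' hk v)))) with hin | hin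
  · obtain ⟨⟨⟨hus, hus'⟩, ⟨hut, hut'⟩⟩, ⟨⟨hvs, hvs'⟩, ⟨hvt, hvt'⟩⟩⟩ := hin
    have h := X_sub_X_inside_le hN D D' hk hcf hw hw' hk1 hRM hMh hP hC hδ hdiff u hu hus hut hus' hut' v hv hvs hvt hvs' hvt'
    refine h.trans ?_
    rw [mul_assoc, mul_assoc (_ + _)]
    exact mul_le_mul_of_nonneg_right (le_add_of_nonneg_right hK2) hZ
  · have hout := not_and_or.1 hin
    have h := X_sub_X_outside_le hN D D' hk hcf hw hw' hk1 hMh hP hA' hδ hXf hXf' u hu v hv hout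
    refine h.trans ?_
    rw [mul_assoc, mul_assoc (_ + _)]
    exact mul_le_mul_of_nonneg_right (le_add_of_nonneg_left hK1) hZ

end Main

end Literature.MathematicalPhysics.QuantumFieldTheory.Balaban1983to89.B9Thm314QGQFlatV1

end
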